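import Summits.NavierStokesRegularity.NavierStokesRegularity.Theorems.ExtremiserTransienceTwoThirdsPieceIntegralsSet
import Summits.NavierStokesRegularity.NavierStokesRegularity.Theorems.ExtremiserTransienceTwoThirdsPieceExcess
import HarnessLib

/-!
# Route `ExtremiserTransience`, crux `NearExtremalTransiencePerFlow` (stmt-NavierStokesRegularity-26567),
# LINE g10-1 «two_thirds» (ns-idea-10), stub S1a′ — BRICK 2, lemma P3e′: THE LOCALISED SHARP INEQUALITY WITH EXCESS — SET VERSION

`--supports stmt-NavierStokesRegularity-26567` (helper; prover seat ns-net-p2 g13).  Verbatim `piece_excess` (p732734) over measurable sets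
`B ⊆ B⁺` (for the remainder piece of a packing), plus `outer_excess_le`: the excess of the OUTER region `B⁺` is at most the inner bound plus one
more layer term, `J_{B⁺} − κ⋆√(Z_{B⁺}W_{B⁺}) ≤ (J_B − κ⋆√(Z_BW_B)) + A₁ Z_L` (`|sd| ≤ A₁ zd`, monotonicity of `√(ZW)`).
HONEST FRAMING: nothing about Navier–Stokes is proved; no summit is proved by a line. [folklore]
-/

noncomputable section

open scoped Topology InnerProductSpace RealInnerProductSpace ENNReal NNReal ContDiff
open MeasureTheory Filter Set Metric
open Literature.Analysis.FluidPDE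
open Summit.NavierStokesRegularity.NavierStokesRegularity.Theorems.DepletionLadder.KStar.HalfSpace
open Summit.NavierStokesRegularity.NavierStokesRegularity.Theorems.DepletionLadder
open Summit.NavierStokesRegularity.NavierStokesRegularity.Theorems.NearExtremalTransiencePerFlow.LocalMaximiser

namespace Summit.NavierStokesRegularity.NavierStokesRegularity.Theorems.NearExtremalTransiencePerFlow.TwoThirds

-- the summit's namespace repeats the problem name by convention (D-0017)
set_option linter.dupNamespace false

section ExcessSet

variable {w φ : E3 → E3} {χ : E3 → ℝ} {B Bp : Set E3} {A₁ m m₃ j₁ j₂ : ℝ}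

/-- **THE LOCALISED SHARP INEQUALITY WITH EXCESS, measurable-set version** (inner region `B`, layer `B⁺ ∖ B`). [folklore] -/
theorem piece_excess_set (hw : ContDiff ℝ (⊤ : ℕ∞) w) (hDw : ∀ x, ‖fderiv ℝ w x‖ ≤ A₁)
    (h1 : ∫⁻ x, ‖iteratedFDeriv ℝ 1 w x‖ₑ ^ 2 < ⊤) (h2 : ∫⁻ x, ‖iteratedFDeriv ℝ 2 w x‖ₑ ^ 2 < ⊤)
    (hφ : ContDiff ℝ (⊤ : ℕ∞) φ) (hφc : HasCompactSupport φ) (hφdiv : VectorCalculus.IsDivFree φ)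
    (hm : 0 ≤ m) (hM : ∀ x, ‖φ x‖ ≤ 1 + m) (hBm : MeasurableSet B) (hBpm : MeasurableSet Bp) (hsubB : B ⊆ Bp)
    (hχc : Continuous χ) (hχ01 : ∀ x, 0 ≤ χ x ∧ χ x ≤ 1) (hone : ∀ x ∈ B, χ x = 1)
    (hχout : ∀ x, x ∉ Bp → χ x = 0)
    (he1 : ∀ x, x ∉ Bp \ B → curl φ x - χ x • curl w x = 0)
    (hi1 : Integrable fun x => ‖curl φ x - χ x • curl w x‖ ^ 2) (hj₁ : ∫ x, ‖curl φ x - χ x • curl w x‖ ^ 2 ≤ j₁)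
    (he2 : ∀ x, x ∉ Bp \ B → fderiv ℝ (curl φ) x - χ x • fderiv ℝ (curl w) x = 0)
    (hi2 : Integrable fun x => ‖fderiv ℝ (curl φ) x - χ x • fderiv ℝ (curl w) x‖ ^ 2)
    (hj₂ : ∫ x, ‖fderiv ℝ (curl φ) x - χ x • fderiv ℝ (curl w) x‖ ^ 2 ≤ j₂)
    (hm₃ : 0 ≤ m₃) (he3 : ∀ x, ‖fderiv ℝ φ x - χ x • fderiv ℝ w x‖ ≤ m₃) {t : ℝ} (ht : 0 < t) :
    (∫ x in B, sd w x) - kStar * Real.sqrt ((∫ x in B, zd w x) * (∫ x in B, wd w x)) ≤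
      kStar * (m / 2 * ((∫ x in B, zd w x) + (2 * ((∫ x in Bp, zd w x) - (∫ x in B, zd w x)) + 2 * j₁) + (∫ x in B, wd w x) + (2 * ((∫ x in Bp, wd w x) - (∫ x in B, wd w x)) + 6 * j₂)) +
        t / 2 * ((∫ x in B, zd w x) + (∫ x in B, wd w x)) +
        (1 / (2 * t) + 1 / 2) * ((2 * ((∫ x in Bp, zd w x) - (∫ x in B, zd w x)) + 2 * j₁) + (2 * ((∫ x in Bp, wd w x) - (∫ x in B, wd w x)) + 6 * j₂))) +
      (2 * A₁ * ((∫ x in Bp, zd w x) - (∫ x in B, zd w x)) + 2 * A₁ * j₁) +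
      m₃ * ((∫ x in B, zd w x) + (2 * ((∫ x in Bp, zd w x) - (∫ x in B, zd w x)) + 2 * j₁)) := by
  have hw2 : ContDiff ℝ 2 w := hw.of_le (by norm_cast)
  have hw3 : ContDiff ℝ 3 w := hw.of_le (by norm_cast)
  have hφ1 : ContDiff ℝ 1 φ := hφ.of_le (by norm_cast)
  have hφ2 : ContDiff ℝ 2 φ := hφ.of_le (by norm_cast)
  have hZ := Zen_piece_le_set hw2 h1 hφ1 hφc hBm hBpm hsubB hχ01 hχout he1 hi1 hj₁
  have hW := Wpa_piece_le_set hw3 h2 hφ2 hφc hBm hBpm hsubB hχ01 hχout he2 hi2 hj₂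
  have hJ := Jst_piece_ge_set hw hDw h1 hφ hφc hBm hBpm hsubB hχc hχ01 hone hχout he1 hi1 hj₁ he3
  have hsharp := Jst_le_sharp hφ hφc hφdiv hM
  -- signs
  have izd : Integrable (zd w) := (integrable_norm_curl_sq hw2 h1).1
  have iwd : Integrable (wd w) := (integrable_frobeniusNormSq_fderiv_curl hw3 h2).1
  have hZb0 : 0 ≤ (∫ x in B, zd w x) := setIntegral_nonneg hBm fun x _ => sq_nonneg _
  have hWb0 : 0 ≤ (∫ x in B, wd w x) := setIntegral_nonneg hBm fun x _ => frobeniusNormSq_nonneg _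
  have hZL : (∫ x in B, zd w x) ≤ (∫ x in Bp, zd w x) :=
    setIntegral_mono_set izd.integrableOn (ae_of_all _ fun x => sq_nonneg _) (Eventually.of_forall hsubB)
  have hWL : (∫ x in B, wd w x) ≤ (∫ x in Bp, wd w x) :=
    setIntegral_mono_set iwd.integrableOn (ae_of_all _ fun x => frobeniusNormSq_nonneg _) (Eventually.of_forall hsubB)
  have hZL0 : 0 ≤ (∫ x in Bp, zd w x) - (∫ x in B, zd w x) := by linarith only [hZL]
  have hWL0 : 0 ≤ (∫ x in Bp, wd w x) - (∫ x in B, wd w x) := by linarith only [hWL]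
  have hj₁0 : 0 ≤ j₁ := (integral_nonneg fun x => sq_nonneg _).trans hj₁
  have hj₂0 : 0 ≤ j₂ := (integral_nonneg fun x => sq_nonneg _).trans hj₂
  have hA₁ : 0 ≤ A₁ := (norm_nonneg _).trans (hDw 0)
  exact excess_algebra (le_of_lt kStar_pos) hm hm₃ ht hZb0 hWb0 (by positivity) (by positivity) hsharp hZ hW
    (by linarith only [hJ])


/-- **Outer excess from inner excess**: `J_{B⁺} − κ⋆√(Z_{B⁺} W_{B⁺}) ≤ J_B − κ⋆√(Z_B W_B) + A₁ (Z_{B⁺} − Z_B)`. [folklore] -/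
theorem outer_excess_le (hw : ContDiff ℝ (⊤ : ℕ∞) w) (hDw : ∀ x, ‖fderiv ℝ w x‖ ≤ A₁)
    (h1 : ∫⁻ x, ‖iteratedFDeriv ℝ 1 w x‖ₑ ^ 2 < ⊤) (h2 : ∫⁻ x, ‖iteratedFDeriv ℝ 2 w x‖ₑ ^ 2 < ⊤)
    (hBm : MeasurableSet B) (hBpm : MeasurableSet Bp) (hsubB : B ⊆ Bp) :
    (∫ x in Bp, sd w x) - kStar * Real.sqrt ((∫ x in Bp, zd w x) * (∫ x in Bp, wd w x)) ≤
      (∫ x in B, sd w x) - kStar * Real.sqrt ((∫ x in B, zd w x) * (∫ x in B, wd w x)) +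
        A₁ * ((∫ x in Bp, zd w x) - (∫ x in B, zd w x)) := by
  have hw2 : ContDiff ℝ 2 w := hw.of_le (by norm_cast)
  have hw3 : ContDiff ℝ 3 w := hw.of_le (by norm_cast)
  have izd : Integrable (zd w) := (integrable_norm_curl_sq hw2 h1).1
  have iwd : Integrable (wd w) := (integrable_frobeniusNormSq_fderiv_curl hw3 h2).1
  have isd : Integrable (sd w) := KStar.integrable_stretching hw hDw h1
  have hzd0 : ∀ y, 0 ≤ zd w y := fun y => sq_nonneg _
  -- split `B⁺ = B ∪ L`
  have hJ : (∫ x in Bp \ B, sd w x) = (∫ x in Bp, sd w x) - ∫ x in B, sd w x := setIntegral_sdiff hBm isd.integrableOn hsubB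
  have hZ : (∫ x in Bp \ B, zd w x) = (∫ x in Bp, zd w x) - ∫ x in B, zd w x := setIntegral_sdiff hBm izd.integrableOn hsubB
  -- `|J_L| ≤ A₁ Z_L`
  have hJL : (∫ x in Bp \ B, sd w x) ≤ A₁ * ∫ x in Bp \ B, zd w x := by
    rw [← integral_const_mul]
    refine setIntegral_mono_on isd.integrableOn (izd.integrableOn.const_mul _) (hBpm.diff hBm) fun x _ => ?_
    have h := (abs_sd_le w x).trans (mul_le_mul_of_nonneg_right (hDw x) (hzd0 x))
    exact (le_abs_self _).trans h
  -- monotonicity of `√(ZW)`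
  have hZmono : (∫ x in B, zd w x) ≤ ∫ x in Bp, zd w x :=
    setIntegral_mono_set izd.integrableOn (ae_of_all _ hzd0) (Eventually.of_forall hsubB)
  have hWmono : (∫ x in B, wd w x) ≤ ∫ x in Bp, wd w x :=
    setIntegral_mono_set iwd.integrableOn (ae_of_all _ fun x => frobeniusNormSq_nonneg _) (Eventually.of_forall hsubB)
  have hZ0 : 0 ≤ ∫ x in B, zd w x := setIntegral_nonneg hBm fun x _ => hzd0 x
  have hW0 : 0 ≤ ∫ x in B, wd w x := setIntegral_nonneg hBm fun x _ => frobeniusNormSq_nonneg _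
  have hsqrt : Real.sqrt ((∫ x in B, zd w x) * (∫ x in B, wd w x)) ≤ Real.sqrt ((∫ x in Bp, zd w x) * (∫ x in Bp, wd w x)) :=
    Real.sqrt_le_sqrt (mul_le_mul hZmono hWmono hW0 (hZ0.trans hZmono))
  have hκ : 0 ≤ kStar := le_of_lt kStar_pos
  rw [hJ, hZ] at hJL
  have hk := mul_le_mul_of_nonneg_left hsqrt hκ
  linarith only [hJL, hk]

end ExcessSet

end Summit.NavierStokesRegularity.NavierStokesRegularity.Theorems.NearExtremalTransiencePerFlow.TwoThirds

end
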